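import Summits.MatrixMultiplication.MatrixMultiplication.Theorems.ConeTensor
import Literature.Computability.AlgebraicComplexity.SmallFormatRank
import Mathlib.Analysis.SpecialFunctions.Log.Base
import HarnessLib

/-!
# Squared-spoke cone — Kronecker self-similarity and finite level certificates

Decomposition-workshop lens 6 («barrier-complement carving»), generation 14, kernel content for the
node `ConeCarving` (attacked conjunct `ConeFlat : ω(W) ≤ 6`). This file makes the attacked conjunct
INSTRUMENTABLE in kernel, exactly as `TetrahedronTensorKronecker` / `TetrahedronTensorLevels` did for
the tetrahedron:

* `cone_mul_apply` — pointwise Kronecker factorisation `W_{N·M}(i) = W_N(κ₁ ∘ i) · W_M(κ₂ ∘ i)` (labels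
  `Fin (N·M) ≃ Fin N × Fin M`), hence `tensorRankD_cone_mul_le : R₄(W_{N·M}) ≤ R₄(W_N) · R₄(W_M)` and
  `tensorRankD_cone_pow_le`;
* `tensorRankD_cone_mono` — monotonicity in the level (pullback along `Fin n ↪ Fin m`);
* `omegaCone_le_of_level` — ONE finite certificate `R₄(W_N) ≤ N^θ` (`N ≥ 2`) gives `ω(W) ≤ θ`;
  `omegaCone_le_six_of_levels` / `levels_of_omegaCone_le_six` / `omegaCone_le_six_iff_levels` —
  `ConeFlat` is EQUIVALENT to its finite-certificate form; `omegaCone_le_logb_level`.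

All statements hold over every field. Sorry-free.
-/

noncomputable section

set_option linter.dupNamespace false

namespace Summit.MatrixMultiplication.MatrixMultiplication.Theorems.ConeTensor

open Finset Filter Asymptotics
open Literature.Computability.AlgebraicComplexity
open Summit.MatrixMultiplication.MatrixMultiplication.Theorems.TetrahedronTensor

/-! ## Kronecker self-similarity `W_{N·M} ≅ W_N ⊠ W_M` -/

section Kronecker

variable {F : Type*} [Field F]

/-- First (`Fin N`) components of the six half-labels of a cone leg index at the product level
`N·M` (half-labels `Fin (N·M) ≃ Fin N × Fin M` via `finProdFinEquiv`), re-encoded as a level-`N`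
cone leg index. -/
def κ₁ {N M : ℕ} (x : Fin (((N * M) * (N * M)) ^ 3)) : Fin ((N * N) ^ 3) :=
  finFunctionFinEquiv fun s =>
    finProdFinEquiv ((finProdFinEquiv.symm (P₁ x s)).1, (finProdFinEquiv.symm (P₂ x s)).1)

/-- Second (`Fin M`) components of the six half-labels of a cone leg index at the product level
`N·M`, re-encoded as a level-`M` cone leg index. -/
def κ₂ {N M : ℕ} (x : Fin (((N * M) * (N * M)) ^ 3)) : Fin ((M * M) ^ 3) :=
  finFunctionFinEquiv fun s =>
    finProdFinEquiv ((finProdFinEquiv.symm (P₁ x s)).2, (finProdFinEquiv.symm (P₂ x s)).2)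

/-- First halves of `κ₁ x` are the `Fin N`-components of the first halves of `x`. -/
@[simp] theorem P₁_κ₁ {N M : ℕ} (x : Fin (((N * M) * (N * M)) ^ 3)) (s : Fin 3) :
    P₁ (κ₁ x) s = (finProdFinEquiv.symm (P₁ x s)).1 := by
  simp [P₁, P₂, κ₁]

/-- Second halves of `κ₁ x` are the `Fin N`-components of the second halves of `x`. -/
@[simp] theorem P₂_κ₁ {N M : ℕ} (x : Fin (((N * M) * (N * M)) ^ 3)) (s : Fin 3) :
    P₂ (κ₁ x) s = (finProdFinEquiv.symm (P₂ x s)).1 := by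
  simp [P₁, P₂, κ₁]

/-- First halves of `κ₂ x` are the `Fin M`-components of the first halves of `x`. -/
@[simp] theorem P₁_κ₂ {N M : ℕ} (x : Fin (((N * M) * (N * M)) ^ 3)) (s : Fin 3) :
    P₁ (κ₂ x) s = (finProdFinEquiv.symm (P₁ x s)).2 := by
  simp [P₁, P₂, κ₂]

/-- Second halves of `κ₂ x` are the `Fin M`-components of the second halves of `x`. -/
@[simp] theorem P₂_κ₂ {N M : ℕ} (x : Fin (((N * M) * (N * M)) ^ 3)) (s : Fin 3) :
    P₂ (κ₂ x) s = (finProdFinEquiv.symm (P₂ x s)).2 := by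
  simp [P₁, P₂, κ₂]

/-- **Pointwise Kronecker factorisation** `W_{N·M}(i) = W_N(κ₁ ∘ i) · W_M(κ₂ ∘ i)`: the nine
half-label equalities defining the cone hold in `Fin (N·M)` iff they hold componentwise.
[cite: ChristandlVranaZuiddam2016, §1.1 and §2.1 (graph tensors multiply under ⊠)] -/
theorem cone_mul_apply {N M : ℕ} (i : Fin 4 → Fin (((N * M) * (N * M)) ^ 3)) :
    cone F (N * M) i = cone F N (fun v => κ₁ (i v)) * cone F M (fun v => κ₂ (i v)) := by
  have e : ∀ x y : Fin (N * M), x = y ↔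
      ((finProdFinEquiv.symm x).1 = (finProdFinEquiv.symm y).1 ∧
        (finProdFinEquiv.symm x).2 = (finProdFinEquiv.symm y).2) := fun x y => by
    rw [← Prod.ext_iff, Equiv.apply_eq_iff_eq]
  simp only [cone, matMulTensor, ite_one_zero_mul_ite, P₁_κ₁, P₂_κ₁, P₁_κ₂, P₂_κ₂]
  refine if_congr ?_ rfl rfl
  simp only [e]
  tauto

/-- **Kronecker sub-multiplicativity** `R₄(W_{N·M}) ≤ R₄(W_N) · R₄(W_M)`: products of the legs of
two rank-one decompositions (through `κ₁`, `κ₂`) decompose `W_{N·M}`.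
[cite: ChristandlVranaZuiddam2016, Prop. 1.1.16 (proof)] -/
theorem tensorRankD_cone_mul_le (N M : ℕ) :
    tensorRankD (cone F (N * M)) ≤ tensorRankD (cone F N) * tensorRankD (cone F M) := by
  classical
  obtain ⟨u₁, hu₁⟩ := exists_rankOne_decomposition_cone (F := F) N
  obtain ⟨u₂, hu₂⟩ := exists_rankOne_decomposition_cone (F := F) M
  set L : Fin (tensorRankD (cone F N)) × Fin (tensorRankD (cone F M)) →
      Fin 4 → Fin (((N * M) * (N * M)) ^ 3) → F :=
    fun k v x => u₁ k.1 v (κ₁ x) * u₂ k.2 v (κ₂ x) with hL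
  have hsum : ∑ k, rankOneTensor (L k) = cone F (N * M) := by
    funext i
    rw [Finset.sum_apply, Fintype.sum_prod_type, cone_mul_apply,
      ← congrFun hu₁ (fun v => κ₁ (i v)), ← congrFun hu₂ (fun v => κ₂ (i v)),
      Finset.sum_apply, Finset.sum_apply, Finset.sum_mul_sum]
    refine Finset.sum_congr rfl fun k₁ _ => Finset.sum_congr rfl fun k₂ _ => ?_
    simp only [rankOneTensor_apply, hL, ← Finset.prod_mul_distrib]
  have hcard : Fintype.card (Fin (tensorRankD (cone F N)) × Fin (tensorRankD (cone F M))) =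
      tensorRankD (cone F N) * tensorRankD (cone F M) := by simp
  rw [← hcard]
  let e := Fintype.equivFin (Fin (tensorRankD (cone F N)) × Fin (tensorRankD (cone F M)))
  refine tensorRankD_le_of_eq_sum (fun k => L (e.symm k)) ?_
  rw [← hsum]
  exact Fintype.sum_equiv e.symm _ _ (fun _ => rfl)

/-- Powers of a level: `R₄(W_{N^j}) ≤ R₄(W_N)^j`. [cite: ChristandlVranaZuiddam2016, Prop. 1.1.16 (proof)] -/
theorem tensorRankD_cone_pow_le (N j : ℕ) :
    tensorRankD (cone F (N ^ j)) ≤ tensorRankD (cone F N) ^ j := by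
  induction j with
  | zero =>
    rw [pow_zero, pow_zero]
    have h : tensorRankD (cone F 1) ≤ 1 ^ 9 := tensorRankD_cone_le_pow_nine (F := F) 1
    simpa using h
  | succ j ih =>
    calc tensorRankD (cone F (N ^ (j + 1)))
        = tensorRankD (cone F (N ^ j * N)) := by rw [pow_succ N j]
      _ ≤ tensorRankD (cone F (N ^ j)) * tensorRankD (cone F N) := tensorRankD_cone_mul_le _ _
      _ ≤ tensorRankD (cone F N) ^ j * tensorRankD (cone F N) := Nat.mul_le_mul_right _ ih
      _ = tensorRankD (cone F N) ^ (j + 1) := (pow_succ _ j).symm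

/-! ## Monotonicity in the level -/

/-- The label embedding `Fin n ↪ Fin m` (`n ≤ m`) applied to all six half-labels of a cone leg index. -/
def coneLift {n m : ℕ} (h : n ≤ m) (x : Fin ((n * n) ^ 3)) : Fin ((m * m) ^ 3) :=
  finFunctionFinEquiv fun s => finProdFinEquiv (Fin.castLE h (P₁ x s), Fin.castLE h (P₂ x s))

/-- First halves of a lifted index. -/
@[simp] theorem P₁_coneLift {n m : ℕ} (h : n ≤ m) (x : Fin ((n * n) ^ 3)) (s : Fin 3) :
    P₁ (coneLift h x) s = Fin.castLE h (P₁ x s) := by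
  simp [P₁, P₂, coneLift]

/-- Second halves of a lifted index. -/
@[simp] theorem P₂_coneLift {n m : ℕ} (h : n ≤ m) (x : Fin ((n * n) ^ 3)) (s : Fin 3) :
    P₂ (coneLift h x) s = Fin.castLE h (P₂ x s) := by
  simp [P₁, P₂, coneLift]

/-- `W_n` is the pullback of `W_m` along the label embedding (`n ≤ m`). [folklore] -/
theorem cone_eq_pullback_lift {n m : ℕ} (h : n ≤ m) :
    cone F n = fun i : Fin 4 → Fin ((n * n) ^ 3) => cone F m (fun v => coneLift h (i v)) := by
  funext i
  simp only [cone, matMulTensor, P₁_coneLift, P₂_coneLift, (Fin.castLE_injective h).eq_iff]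

/-- **Monotonicity in the level**: `R₄(W_n) ≤ R₄(W_m)` for `n ≤ m`. [folklore] -/
theorem tensorRankD_cone_mono {n m : ℕ} (h : n ≤ m) :
    tensorRankD (cone F n) ≤ tensorRankD (cone F m) := by
  rw [cone_eq_pullback_lift (F := F) h]
  exact tensorRankD_pullback_le (cone F m) (fun _ x => coneLift h x) (cone_decomposable m)

end Kronecker

/-! ## From one level certificate to the exponent, and back -/

section Level

variable (F : Type*) [Field F]

/-- **Level certificate ⟹ admissible exponent.** If `R₄(W_N) ≤ N^θ` at some level `N ≥ 2`
(`θ ≥ 0`), then `R₄(W_n) ≤ N^θ · n^θ` for all `n ≥ 1`, so `θ ∈ coneAdmissibleExponents`.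
[cite: ChristandlVranaZuiddam2016, Prop. 1.1.16] -/
theorem mem_coneAdmissibleExponents_of_level {N : ℕ} {θ : ℝ} (hN : 2 ≤ N) (hθ : 0 ≤ θ)
    (hcert : (tensorRankD (cone F N) : ℝ) ≤ (N : ℝ) ^ θ) :
    θ ∈ coneAdmissibleExponents F := by
  have hNpos : 0 < N := by omega
  have hNposR : (0 : ℝ) < N := by exact_mod_cast hNpos
  have hpow : ∀ j : ℕ, (tensorRankD (cone F (N ^ j)) : ℝ) ≤ ((N : ℝ) ^ θ) ^ j := fun j =>
    calc (tensorRankD (cone F (N ^ j)) : ℝ) ≤ ((tensorRankD (cone F N) : ℕ) : ℝ) ^ j := by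
          exact_mod_cast tensorRankD_cone_pow_le (F := F) N j
      _ ≤ ((N : ℝ) ^ θ) ^ j := pow_le_pow_left₀ (Nat.cast_nonneg _) hcert j
  refine IsBigO.of_bound ((N : ℝ) ^ θ) ?_
  filter_upwards [eventually_ge_atTop 1] with n hn
  rw [Real.norm_of_nonneg (Nat.cast_nonneg _),
    Real.norm_of_nonneg (Real.rpow_nonneg (Nat.cast_nonneg _) _)]
  set j : ℕ := Nat.log N n + 1 with hj
  have hlt : n < N ^ j := Nat.lt_pow_succ_log_self (by omega) n
  have hle : N ^ j ≤ N * n := by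
    rw [hj, pow_succ, mul_comm]
    exact Nat.mul_le_mul_left N (Nat.pow_log_le_self N (by omega))
  have hmono : tensorRankD (cone F n) ≤ tensorRankD (cone F (N ^ j)) :=
    tensorRankD_cone_mono (F := F) hlt.le
  have hcast : ((N : ℝ) ^ θ) ^ j = ((N ^ j : ℕ) : ℝ) ^ θ := by
    rw [Nat.cast_pow, ← Real.rpow_natCast ((N : ℝ) ^ θ) j, ← Real.rpow_mul hNposR.le, mul_comm θ,
      Real.rpow_mul hNposR.le, Real.rpow_natCast]
  have hNj : ((N ^ j : ℕ) : ℝ) ≤ (N : ℝ) * (n : ℝ) := by exact_mod_cast hle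
  calc (tensorRankD (cone F n) : ℝ)
      ≤ (tensorRankD (cone F (N ^ j)) : ℝ) := by exact_mod_cast hmono
    _ ≤ ((N : ℝ) ^ θ) ^ j := hpow j
    _ = ((N ^ j : ℕ) : ℝ) ^ θ := hcast
    _ ≤ ((N : ℝ) * (n : ℝ)) ^ θ := Real.rpow_le_rpow (Nat.cast_nonneg _) hNj hθ
    _ = (N : ℝ) ^ θ * (n : ℝ) ^ θ := Real.mul_rpow hNposR.le (Nat.cast_nonneg _)

/-- **Level certificate ⟹ exponent bound**: `R₄(W_N) ≤ N^θ` with `N ≥ 2`, `θ ≥ 0` gives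
`ω(W) ≤ θ`. [cite: ChristandlVranaZuiddam2016, Prop. 1.1.16] -/
theorem omegaCone_le_of_level {N : ℕ} {θ : ℝ} (hN : 2 ≤ N) (hθ : 0 ≤ θ)
    (hcert : (tensorRankD (cone F N) : ℝ) ≤ (N : ℝ) ^ θ) : omegaCone F ≤ θ :=
  csInf_le (coneAdmissibleExponents_bddBelow F)
    (mem_coneAdmissibleExponents_of_level F hN hθ hcert)

/-- **Finite certificates for `ConeFlat`.** If for every `k` some level `N ≥ 2` carries a rank
certificate `R₄(W_N) ≤ N^{6 + 1/(k+1)}`, then `ω(W) ≤ 6` (the attacked conjunct of the cone carving,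
in finite-certificate form). [cite: ChristandlVranaZuiddam2016, Prop. 1.1.16] -/
theorem omegaCone_le_six_of_levels
    (hlev : ∀ k : ℕ, ∃ N : ℕ, 2 ≤ N ∧
      (tensorRankD (cone F N) : ℝ) ≤ (N : ℝ) ^ ((6 : ℝ) + 1 / ((k : ℝ) + 1))) :
    omegaCone F ≤ 6 := by
  have hk : ∀ k : ℕ, omegaCone F ≤ (6 : ℝ) + 1 / ((k : ℝ) + 1) := fun k => by
    obtain ⟨N, hN, hcert⟩ := hlev k
    exact omegaCone_le_of_level F hN (by positivity) hcert
  refine le_of_not_gt fun h => ?_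
  obtain ⟨k, hk'⟩ := exists_nat_one_div_lt (sub_pos.2 h)
  have := hk k
  linarith

/-- **Levels from the exponent**: if `ω(W) < θ` then some level `N ≥ 2` carries the certificate
`R₄(W_N) ≤ N^θ`. [cite: ChristandlVranaZuiddam2016, Prop. 1.1.16] -/
theorem exists_level_of_omegaCone_lt {θ : ℝ} (h : omegaCone F < θ) :
    ∃ N : ℕ, 2 ≤ N ∧ (tensorRankD (cone F N) : ℝ) ≤ (N : ℝ) ^ θ := by
  obtain ⟨β, hωβ, hβθ⟩ := exists_between h
  have hβ := mem_coneAdmissibleExponents_of_lt F hωβ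
  obtain ⟨C, hC⟩ := isBigO_iff.1 hβ
  have hlim : Tendsto (fun n : ℕ => (n : ℝ) ^ (θ - β)) atTop atTop :=
    (tendsto_rpow_atTop (by linarith)).comp tendsto_natCast_atTop_atTop
  obtain ⟨N, hRN, hCN, hN2⟩ :=
    (hC.and ((hlim.eventually_ge_atTop C).and (eventually_ge_atTop 2))).exists
  refine ⟨N, hN2, ?_⟩
  have hN0 : (0 : ℝ) < N := by
    have : 0 < N := lt_of_lt_of_le (by norm_num) hN2
    exact_mod_cast this
  rw [Real.norm_of_nonneg (Nat.cast_nonneg _),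
    Real.norm_of_nonneg (Real.rpow_nonneg (Nat.cast_nonneg _) _)] at hRN
  calc (tensorRankD (cone F N) : ℝ) ≤ C * (N : ℝ) ^ β := hRN
    _ ≤ (N : ℝ) ^ (θ - β) * (N : ℝ) ^ β :=
        mul_le_mul_of_nonneg_right hCN (Real.rpow_nonneg hN0.le _)
    _ = (N : ℝ) ^ θ := by rw [← Real.rpow_add hN0, sub_add_cancel]

/-- `ConeFlat` in finite-certificate form, converse direction: `ω(W) ≤ 6` gives, for every `k`, a
level `N ≥ 2` with `R₄(W_N) ≤ N^{6 + 1/(k+1)}`. [cite: ChristandlVranaZuiddam2016, Prop. 1.1.16] -/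
theorem levels_of_omegaCone_le_six (h : omegaCone F ≤ 6) :
    ∀ k : ℕ, ∃ N : ℕ, 2 ≤ N ∧
      (tensorRankD (cone F N) : ℝ) ≤ (N : ℝ) ^ ((6 : ℝ) + 1 / ((k : ℝ) + 1)) := by
  intro k
  refine exists_level_of_omegaCone_lt F (lt_of_le_of_lt h ?_)
  have hk : (0 : ℝ) < 1 / ((k : ℝ) + 1) := by positivity
  linarith

/-- **`ConeFlat ⟺ Levels`**: `ω(W) ≤ 6` iff every exponent `6 + 1/(k+1)` is certified at some finite
level (the attacked conjunct of the cone carving is EQUIVALENT to its finite-certificate form).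
[cite: ChristandlVranaZuiddam2016, Prop. 1.1.16] -/
theorem omegaCone_le_six_iff_levels :
    omegaCone F ≤ 6 ↔
      ∀ k : ℕ, ∃ N : ℕ, 2 ≤ N ∧
        (tensorRankD (cone F N) : ℝ) ≤ (N : ℝ) ^ ((6 : ℝ) + 1 / ((k : ℝ) + 1)) :=
  ⟨levels_of_omegaCone_le_six F, omegaCone_le_six_of_levels F⟩

/-- `R₄(W_N) ≥ 1` as a real number for `N ≥ 1` (from the flattening `N⁶ ≤ R₄(W_N)`). [folklore] -/
theorem one_le_tensorRankD_cone_real {N : ℕ} (hN : 1 ≤ N) :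
    (1 : ℝ) ≤ (tensorRankD (cone F N) : ℝ) := by
  have h6 := pow_six_le_tensorRankD_cone' (F := F) N
  have h1 : 1 ≤ N ^ 6 := Nat.one_le_pow _ _ hN
  exact_mod_cast h1.trans h6

/-- Every level bounds the exponent: `ω(W) ≤ log_N R₄(W_N)` for `N ≥ 2` (e.g. `N = 2`:
`ω(W) ≤ log₂ R₄(W_2)`, format `64 × 16 × 16 × 16`, bracket `64 ≤ R₄(W_2) ≤ 343`).
[cite: ChristandlVranaZuiddam2016, Prop. 1.1.16] -/
theorem omegaCone_le_logb_level {N : ℕ} (hN : 2 ≤ N) :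
    omegaCone F ≤ Real.logb N (tensorRankD (cone F N)) := by
  have hN1 : (1 : ℝ) < N := by exact_mod_cast (lt_of_lt_of_le (by norm_num) hN : 1 < N)
  have hN0 : (0 : ℝ) < N := by linarith
  have hR1 := one_le_tensorRankD_cone_real F (le_trans (by norm_num) hN)
  have hR0 : (0 : ℝ) < (tensorRankD (cone F N) : ℝ) := by linarith
  refine omegaCone_le_of_level F hN (Real.logb_nonneg hN1 hR1) ?_
  rw [Real.rpow_logb hN0 hN1.ne' hR0]

/-- The level-2 bracket in kernel: `64 ≤ R₄(W_2) ≤ 343` (flattening `2⁶`; cover by Strassen's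
`R(⟨2,2,2⟩) ≤ 7`, cubed). [cite: ChristandlVranaZuiddam2016, §1.2 (table)] -/
theorem tensorRankD_cone_two_bracket :
    64 ≤ tensorRankD (cone F 2) ∧ tensorRankD (cone F 2) ≤ 343 := by
  refine ⟨by simpa using pow_six_le_tensorRankD_cone' (F := F) 2, ?_⟩
  calc tensorRankD (cone F 2) ≤ tensorRank (matMulTensor F 2 2 2) ^ 3 := tensorRankD_cone_le 2
    _ ≤ 7 ^ 3 := Nat.pow_le_pow_left (tensorRank_matMulTensor_two_le_seven F) 3
    _ = 343 := by norm_num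

/-- **First kernel rung of the cone level ladder** (level `N = 2`): `ω(W) ≤ log₂ 343 < 8.43`, over
every field (weaker than the cover `ω(W) ≤ 3ω`, but ω-free and finite: the instrument run end to end).
[cite: ChristandlVranaZuiddam2016, Prop. 1.1.16] -/
theorem omegaCone_le_logb_two_343 : omegaCone F ≤ Real.logb 2 343 := by
  have h1 := omegaCone_le_logb_level F (N := 2) le_rfl
  have hb := tensorRankD_cone_two_bracket F
  have h2 : (tensorRankD (cone F 2) : ℝ) ≤ 343 := by exact_mod_cast hb.2
  have h0 : (0 : ℝ) < (tensorRankD (cone F 2) : ℝ) := by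
    have h64 : 0 < tensorRankD (cone F 2) := lt_of_lt_of_le (by norm_num) hb.1
    exact_mod_cast h64
  calc omegaCone F ≤ Real.logb (2 : ℕ) (tensorRankD (cone F 2)) := h1
    _ = Real.logb 2 (tensorRankD (cone F 2)) := by norm_num
    _ ≤ Real.logb 2 343 := Real.logb_le_logb_of_le (by norm_num) h0 h2

end Level

end Summit.MatrixMultiplication.MatrixMultiplication.Theorems.ConeTensor

end
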